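/-
Copyright: the b2b-balaban T⁴-continuum CRUX team, row NE7b leaf lineage `t4-ne7b-formalise-leaf-05` (gen 157). Project licence.
-/
import Summits.QuantumFields.BalabanUV.T4Continuum.Spine.NE7b.AdmissibleFloorSeminormTerms
import Summits.QuantumFields.BalabanUV.T4Continuum.Spine.NE7b.QuadraticPartitionOfUnity

/-!
# THE SEMINORM-IMS FLOOR FOR LINEAR LOCAL TERMS, DRIVEN BY A LINEAR (TENT) PARTITION — `…AdmissibleFloorSeminormTerms` with the quadratic partition
# `h_s = φ_s∕(Σ_rφ_r²)^{1∕2}` of `…QuadraticPartitionOfUnity`: the instance supplies `φ ≥ 0`-free letters `Σ_s φ_s(c) = 1`, `#{s : φ_s(c) ≠ 0} ≤ μ₀`, an `ℓ²`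
# variation bound `Σ_r (φ_r(c) − φ_r(c_j))² ≤ Λ²` on each term and a term multiplicity `μ`, and gets the floor with `ε = 4μμ₀ℓ²Λ²ab`
# (row NE7b, node U5c; residual (R2′) family (2), letter (ℓ1); junction lemma)

Cell `pub-balaban`, sub-cell `t4`, spine estimate NE7b (`T4WeightBudget.RelWeightBound`; the cell's OWN estimate — NOT PRINTED in [Bałaban 1983–89],
NOT PROVED).  Crux-route work under `Spine/NE7b/`; NOTHING of Bałaban's is asserted; no `def`; zero `sorry`; no `T4Continuum/Support` leaf (FREEZE (0)).
Imports: this lineage's `…AdmissibleFloorSeminormTerms` (AFST: `ims_floor_of_linear_terms`) and `…QuadraticPartitionOfUnity` (QPU: `sum_sq_normalise`,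
`normalise_eq_zero_iff`, `abs_normalise_sub_le`).

WHY.  AFST discharges AFSI's bookkeeping for linear local terms but still displays the QUADRATIC partition `h` (`Σ_s h_s(c)² = 1`, per-term Lipschitz `λ`,
term multiplicity `μ`); QPU carries those letters across the normalisation of a LINEAR partition `φ`.  THIS FILE composes the two, so that the k = 1
instance supplies the partition in its elementary (tent) form only.

WHAT IS PROVED ([folklore]):
* §1 `card_varying_normalise_le` — the cubes whose normalised cutoff varies on a term are among those alive on the term: `#{s : ∃ c ∈ inc j, h_s(c) ≠ h_s(c_j)}
  ≤ #{s : ∃ c ∈ inc j, φ_s(c) ≠ 0 ∨ φ_s(c_j) ≠ 0}` (same support, QPU `normalise_eq_zero_iff`).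
* §2 **`ims_floor_of_linear_partition`** — AFST `ims_floor_of_linear_terms` with `h := φ∕‖φ‖₂`: `hpart` := QPU `sum_sq_normalise`; (Lip) := QPU
  `abs_normalise_sub_le` with the term letter `Σ_r (φ_r(c) − φ_r(c_j))² ≤ Λ²` (`λ = 2√μ₀·Λ`); (mult) := §1 with the term letter `≤ μ`; local floors and `Σ‖T_j x‖² ≤ F`
  as in AFST ⊢ `((c_loc − (1+t⁻¹)·μℓ²(2√μ₀Λ)²ab)∕(1+t))·Σ_c‖x c‖² ≤ F x` on `good`.
* §3 toy: one cube, `φ ≡ 1` (`μ₀ = 1`, `Λ = 0`): the floor `((1 − 2·(1·1·0·1·1))∕2)·Σ‖x c‖² ≤ Σ‖x c‖²` (`example`).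

NOT HERE (honest): the tent partition on the two-scale torus and its `Λ = √(2·2^d)·(L+1)c_h∕M`-type letter; the per-cube gauge letters; anything of Bałaban's.
BY-NAME EFFECT ON THE WALL: NONE.  NE7b NOT PRINTED ∕ NOT PROVED; spine PROVED 0∕9; rung (B)+1 on ONE finite T⁴ — NOT infinite volume, NOT the mass gap, NOT Clay.
HONEST DEPENDENCY: continuum YM on T⁴ ⇐ BetaPertH ∧ nine spine estimates (0/9 proved); BetaPertH ⇐ (D1) ∧ (D4) ∧ CAP+tail; G-an2-4 gates asym, D1 and NE2/3/4.
-/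

set_option autoImplicit false

noncomputable section

open Finset
open Summit.QuantumFields.BalabanUV.T4Continuum.NE7b.AdmissibleFloorSeminormTerms (ims_floor_of_linear_terms)
open Summit.QuantumFields.BalabanUV.T4Continuum.NE7b.QuadraticPartitionOfUnity (sum_sq_normalise normalise_eq_zero_iff abs_normalise_sub_le)

namespace Summit.QuantumFields.BalabanUV.T4Continuum.NE7b.AdmissibleFloorLinearPartition

variable {J ι C : Type*} [Fintype J] [Fintype ι] [Fintype C]
variable {W V : Type*} [NormedAddCommGroup W] [NormedSpace ℝ W] [NormedAddCommGroup V] [NormedSpace ℝ V]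

/-! ## §1 The cubes whose normalised cutoff varies on a term are alive on the term -/

omit [Fintype J] [Fintype C] in
/-- `#{s : ∃ c ∈ inc j, h_s(c) ≠ h_s(c_j)} ≤ #{s : ∃ c ∈ inc j, φ_s(c) ≠ 0 ∨ φ_s(c_j) ≠ 0}` for `h = φ∕‖φ‖₂` (if `φ_s` vanishes at `c` and at `c_j`, so does
`h_s`, and the two values agree). [folklore] -/
theorem card_varying_normalise_le (φ : ι → C → ℝ) (hsum : ∀ c, ∑ s, φ s c = 1)
    {μ₀ : ℕ} (hmult : ∀ c, (Finset.univ.filter fun s => φ s c ≠ 0).card ≤ μ₀) (inc : J → Finset C) (ref : J → C) (j : J) :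
    (Finset.univ.filter fun s => ∃ c ∈ inc j,
        φ s c / Real.sqrt (∑ r, φ r c ^ 2) ≠ φ s (ref j) / Real.sqrt (∑ r, φ r (ref j) ^ 2)).card
      ≤ (Finset.univ.filter fun s => ∃ c ∈ inc j, φ s c ≠ 0 ∨ φ s (ref j) ≠ 0).card := by
  classical
  refine Finset.card_le_card (Finset.monotone_filter_right _ fun s _ hs => ?_)
  obtain ⟨c, hc, hne⟩ := hs
  refine ⟨c, hc, ?_⟩
  by_contra h0
  obtain ⟨h1, h2⟩ := not_or.mp h0
  exact hne (by rw [(normalise_eq_zero_iff φ hsum hmult s c).mpr (not_not.mp h1),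
    (normalise_eq_zero_iff φ hsum hmult s (ref j)).mpr (not_not.mp h2)])

/-! ## §2 The floor driven by a linear partition -/

/-- **THE SEMINORM-IMS FLOOR FOR LINEAR LOCAL TERMS, LINEAR-PARTITION FORM**: terms `T_j x = Σ_{c∈inc j} R_{j,c}(x c)` (`‖R_{j,c}v‖ ≤ ℓ‖v‖`), a LINEAR
partition `φ` (`Σ_s φ_s(c) = 1`, `#{s : φ_s(c) ≠ 0} ≤ μ₀`) with the term letters `Σ_r (φ_r(c) − φ_r(c_j))² ≤ Λ²` (`c ∈ inc j`, `0 ≤ Λ`) and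
`#{s : ∃ c ∈ inc j, φ_s(c) ≠ 0 ∨ φ_s(c_j) ≠ 0} ≤ μ`, counts `a, b`; with `h_s := φ_s∕(Σ_rφ_r²)^{1∕2}`: local floors `c_loc·Σ_c‖h_s(c)•x(c)‖² ≤ Σ_j‖T_j(h_s•x)‖²`
on `good` and `Σ_j‖T_j x‖² ≤ F x` on `good` ⊢ `((c_loc − (1+t⁻¹)·μℓ²(2√μ₀Λ)²ab)∕(1+t))·Σ_c‖x c‖² ≤ F x` (AFST `ims_floor_of_linear_terms` ∘ QPU). [folklore] -/
theorem ims_floor_of_linear_partition [DecidableEq C] (inc : J → Finset C) (R : J → C → W →ₗ[ℝ] V) {ℓ : ℝ}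
    (hR : ∀ j c v, ‖R j c v‖ ≤ ℓ * ‖v‖)
    (φ : ι → C → ℝ) (hsum : ∀ c, ∑ s, φ s c = 1)
    {μ₀ : ℕ} (hmult : ∀ c, (Finset.univ.filter fun s => φ s c ≠ 0).card ≤ μ₀) (ref : J → C)
    {Λ : ℝ} (hΛ : 0 ≤ Λ) (hvar : ∀ j, ∀ c ∈ inc j, ∑ r, (φ r c - φ r (ref j)) ^ 2 ≤ Λ ^ 2)
    {μ a b : ℕ} (hμ : ∀ j, (Finset.univ.filter fun s => ∃ c ∈ inc j, φ s c ≠ 0 ∨ φ s (ref j) ≠ 0).card ≤ μ)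
    (ha : ∀ j, (inc j).card ≤ a) (hb : ∀ c, (Finset.univ.filter fun j => c ∈ inc j).card ≤ b)
    (good : (C → W) → Prop) {cloc : ℝ}
    (hloc : ∀ s x, good x → cloc * ∑ c, ‖(φ s c / Real.sqrt (∑ r, φ r c ^ 2)) • x c‖ ^ 2
      ≤ ∑ j, ‖∑ c ∈ inc j, R j c ((φ s c / Real.sqrt (∑ r, φ r c ^ 2)) • x c)‖ ^ 2)
    (F : (C → W) → ℝ) (hF : ∀ x, good x → ∑ j, ‖∑ c ∈ inc j, R j c (x c)‖ ^ 2 ≤ F x)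
    {t : ℝ} (ht : 0 < t) (x : C → W) (hx : good x) :
    (cloc - (1 + t⁻¹) * (μ * ℓ ^ 2 * (2 * Real.sqrt μ₀ * Λ) ^ 2 * a * b)) / (1 + t) * ∑ c, ‖x c‖ ^ 2 ≤ F x := by
  classical
  -- the three partition letters of AFST for `h := φ∕‖φ‖₂`
  have hpart : ∀ c, ∑ s, (φ s c / Real.sqrt (∑ r, φ r c ^ 2)) ^ 2 = 1 := fun c => sum_sq_normalise φ hsum hmult c
  have hlip : ∀ s j, ∀ c ∈ inc j,
      |φ s c / Real.sqrt (∑ r, φ r c ^ 2) - φ s (ref j) / Real.sqrt (∑ r, φ r (ref j) ^ 2)| ≤ 2 * Real.sqrt μ₀ * Λ := by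
    intro s j c hc
    refine (abs_normalise_sub_le φ hsum hmult s c (ref j)).trans ?_
    have hs : Real.sqrt (∑ r, (φ r c - φ r (ref j)) ^ 2) ≤ Λ := by
      rw [← Real.sqrt_sq hΛ]
      exact Real.sqrt_le_sqrt (hvar j c hc)
    exact mul_le_mul_of_nonneg_left hs (by positivity)
  have hμ' : ∀ j, (Finset.univ.filter fun s => ∃ c ∈ inc j,
      φ s c / Real.sqrt (∑ r, φ r c ^ 2) ≠ φ s (ref j) / Real.sqrt (∑ r, φ r (ref j) ^ 2)).card ≤ μ :=
    fun j => (card_varying_normalise_le φ hsum hmult inc ref j).trans (hμ j)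
  exact ims_floor_of_linear_terms inc R hR (fun s c => φ s c / Real.sqrt (∑ r, φ r c ^ 2)) hpart ref
    (lam := 2 * Real.sqrt μ₀ * Λ) (by positivity) hlip hμ' ha hb good hloc F hF ht x hx

/-! ## §3 Toy: one cube, `φ ≡ 1` -/

section Toy

/- `J = ι = C = Unit`, `W = V = ℝ`, `inc _ = {()}`, `R = id` (`ℓ = 1`), `φ ≡ 1` (`μ₀ = 1`, `Λ = 0`, `μ = 1`), `a = b = 1`, `good = True`, `c_loc = 1`,
`F x = Σ‖x c‖²`, `t = 1`. -/
example (x : Unit → ℝ) :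
    (1 - (1 + (1 : ℝ)⁻¹) * ((1 : ℕ) * (1 : ℝ) ^ 2 * (2 * Real.sqrt (1 : ℕ) * 0) ^ 2 * (1 : ℕ) * (1 : ℕ))) / (1 + 1) * ∑ c, ‖x c‖ ^ 2
      ≤ ∑ c, ‖x c‖ ^ 2 :=
  ims_floor_of_linear_partition (J := Unit) (ι := Unit) (C := Unit) (W := ℝ) (V := ℝ)
    (fun _ => {()}) (fun _ _ => LinearMap.id) (ℓ := 1) (fun _ _ v => by simp)
    (fun _ _ => (1 : ℝ)) (fun _ => by simp) (μ₀ := 1) (fun _ => by simp) (fun _ => ()) (Λ := 0) le_rfl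
    (fun _ _ _ => by simp) (μ := 1) (a := 1) (b := 1) (fun _ => by simp) (fun _ => by simp) (fun _ => by simp)
    (fun _ => True) (cloc := 1) (fun _ y _ => by simp) (fun y => ∑ c, ‖y c‖ ^ 2) (fun y _ => by simp) one_pos x trivial

end Toy

end Summit.QuantumFields.BalabanUV.T4Continuum.NE7b.AdmissibleFloorLinearPartition

end
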